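import Summits.BirchSwinnertonDyer.BirchSwinnertonDyer.Theorems.ResidualThetaTransportAtTwoDefs
import Literature.NumberTheory.EllipticCurves.GreenbergSelmerCofreeGaloisModule
import HarnessLib

/-!
# Route `ResidualThetaTransportAtTwo` (RTT) — definition file 2: the S₀-SIDE FRAME of line `onepair` (crux RSL_g `ResidualSignedLambdaLowerCMAtTwo`,
# stmt-BirchSwinnertonDyer-22608): `D_w`, `j_{n,k}`, the coset-indexed localisation, `P_{S₀}`, and the pin bundle `AwayPins π`

Cell `bsd-wall`, LEAD `prover-bsd-wall-rtt-p2` g18. Companion of `Theorems/ResidualThetaTransportAtTwoDefs.lean` (`OnePairPins`, the pins at `2`, and the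
habitat abbreviations) — a SECOND module only because that file sits at the 400-line bound; same namespace `…Theorems.OnePair`, same discipline
(DATA-valued definitions and a hypothesis `structure` only: no `Prop`-valued definition, no instance, no notation, nothing asserted). Design of record:
`Cruxes/ResidualSignedLambdaLowerCMAtTwo/AWAYTWO-FRAME-g18.md` (stub-critic rev 22 Q93: no objection; S95/S96/S98 fix how the split texts read it); the
generic Galois-module half (`cofreeGaloisModule`, `cofreeTorsionInclusion`, `cofreeScalar`, `kerGroup`, `kerLocOf`) is
`Literature/NumberTheory/EllipticCurves/GreenbergSelmerCofreeGaloisModule.lean`; the levelwise well-posedness of the value pin is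
`Theorems/…RhoLayerPairingProjectionAwayTwo.lean` (p696153).

CONTENTS (SKELETON-V2-CUT (C1): `A := ℤ₂`; (C5): Pontryagin model at `S₀`, `cS := id`, `locd_S` value-pinned levelwise):
* `nfl w = v₂((ℓ_w² − 1)/8)` (floor = number-of-primes exponent = (P1) threshold); `Dlev S κ ρ w n k = H¹(U_{n,w}, A_ρ[2^k]|)`;
  **`Dloc S κ ρ w = H¹(ℚ_{∞,w̃}, A_ρ)`** (`= subgroupH1 (localSubgroup κ.kerSubgroup ℚ_w) (Cofree (ρ.toLocal w) F)` by `rfl`); `jAway` (restrict + include);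
  `DlocSMul` (functorial scalar action, to which the texts' binder instances `[∀ w, Module ℤ_[2] (Dloc …)]` are pinned); `locKer`, `Cosets`, `locAway`
  (component at the prime labelled by a coset `c`, representative `c.out`); **`PAway S κ ρ S₀ = Π_{w ∈ S₀} Π_{c} CharacterModule (Dloc w)`**.
* **`AwayPins π`**: fields `hD` (scalar pin), `locdS : I.H →+ PAway`, `hlocdS_smul`, `hlocdS` (VALUE PIN from the floor, S2's `ℚ/ℤ` value currency).
Consumers: the split texts S1⊕ / EH / S4₂ / S4₀ (R12 §3.3⁶ items 2, 5–7 over `(π, πₐ)`), the glue `…RhoLayerPairingGlueAwayTwo` (exhaustion of `Dloc`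
by `jAway`, existence/uniqueness of `locdS`), w3's `…LocalBlockCountDloc` (per-block counts). BSD is not proved by any of this; RSL_g is OPEN.

References: [GreenbergVatsal2000] §2 Prop. 2.4; [Greenberg1989] §1; [Kato2004Asterisque] §13.8, §17.13; [PerrinRiou1994Invent] §3.6.1; [Washington1997] §13.1.
-/

set_option autoImplicit false
-- the Theorems namespace of this sub repeats the summit name by design (D-0017 nested layout)
set_option linter.dupNamespace false

noncomputable section

open scoped Classical

namespace Summit.BirchSwinnertonDyer.BirchSwinnertonDyer.Theorems.OnePair

open Literature.NumberTheory.EllipticCurves Literature.NumberTheory.EllipticCurves.GreenbergSelmer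
open Literature.NumberTheory.GaloisRepresentations NumberField IsDedekindDomain Field
open Literature.NumberTheory.EllipticCurves GreenbergSelmer Kobayashi2003 Literature.NumberTheory.GaloisRepresentations
  IsDedekindDomain NumberField Field Rat.HeightOneSpectrum PowerSeries

/-! ## The S₀-side frame of line `onepair` (design `Cruxes/ResidualSignedLambdaLowerCMAtTwo/AWAYTWO-FRAME-g18.md`, stub-critic rev 22 Q93 GO):
`D_w = H¹(ℚ_{∞,w̃}, A_ρ)` in the local dialect of `CyclotomicLayer.layerPairingOf`, the level maps `j`, the functorial scalar action, the
coset-indexed localisation, `P_{S₀} = Π CharacterModule D_w` ((C5): `cS := id`), and the pin bundle `AwayPins π`. Data-valued only. -/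

section AwayFrame

open Literature.NumberTheory.EllipticCurves.CyclotomicLayer CategoryTheory

variable (S : Set (PadicAlgCl 2)) (κ : ZpExtension ℚ 2) (ρ : FramedGaloisRep ℚ ↥(padicCoeffIntegers S) 2)

/-- **The floor `n_w := v₂((ℓ_w² − 1)/8)`**: `2^{n_w}` primes of `ℚ_∞` lie over the odd place `w`, inert from layer `n_w` on, and (P1) at `w`
holds for `n ≥ n_w` (`layerPairingOf_layerCores_odd_two`); literally the exponent in RSL_g's `Σ_g(S₀)`. [cite: Washington1997, §13.1] -/
def nfl (w : HeightOneSpectrum (𝓞 ℚ)) : ℕ :=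
  padicValNat 2 ((Rat.HeightOneSpectrum.natGenerator w ^ 2 - 1) / 8)

/-- **`H¹(U_{n,w}, A_ρ[2^k]|)`** — local classes of layer `n`, level `2^k` (the discrete argument of `layerPairingOf`). [cite: Kobayashi2003, (8.23) (p. 18)] -/
abbrev Dlev (w : HeightOneSpectrum (𝓞 ℚ)) (n k : ℕ) : Type :=
  continuousCohomology 1 (subgroupRep (localRepOf (cofreeTorsionGaloisModule S ρ ((2 ^ k : ℕ) : ℤ)) w) (layerGroup κ w n))

/-- **`D_w := H¹(ℚ_{∞,w̃}, A_ρ)`**, the S₀-side DISCRETE module (full cofree coefficients `cofreeGaloisModule`, group `U_{∞,w} = kerGroup κ w`);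
by `rfl` it is `subgroupH1 (localSubgroup κ.kerSubgroup ℚ_w) (Cofree (ρ.toLocal w) F)`. [cite: GreenbergVatsal2000, §2 Prop. 2.4] -/
abbrev Dloc (w : HeightOneSpectrum (𝓞 ℚ)) : Type :=
  continuousCohomology 1 (subgroupRep (localRepOf (cofreeGaloisModule S ρ) w) (kerGroup κ w))

/-- **`j_{n,k} : H¹(U_{n,w}, A_ρ[2^k]|) →+ D_w`**: restrict to `U_{∞,w}`, then push along `A_ρ[2^k] ↪ A_ρ`; the images over all `(n, k)` exhaust `D_w`
(proved in `…RhoLayerPairingGlueAwayTwo`). [cite: SerreGaloisCohomology1997, I §2.2 Prop. 8] -/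
def jAway (w : HeightOneSpectrum (𝓞 ℚ)) (n k : ℕ) : Dlev S κ ρ w n k →+ Dloc S κ ρ w :=
  (cohomologyMap (subgroupRepMap (Y := localRepOf (cofreeGaloisModule S ρ) w)
      (cofreeTorsionLocalInclusion S ρ ((2 ^ k : ℕ) : ℤ) w) (kerGroup κ w)) 1).hom.toLinearMap.toAddMonoidHom.comp
    (resLe (localRepOf (cofreeTorsionGaloisModule S ρ ((2 ^ k : ℕ) : ℤ)) w) (kerGroup_le_layerGroup κ w n) 1).hom.toLinearMap.toAddMonoidHom

/-- **The scalar action of `a ∈ 𝒪` on `D_w`** (`H¹` of `cofreeLocalScalar`); the split texts carry `[∀ w, Module ℤ_[2] (Dloc …)]` as a BINDER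
pinned to this map (`AwayPins.hD`) — no instance is declared. [cite: Greenberg1989, §1 p. 98] -/
def DlocSMul (w : HeightOneSpectrum (𝓞 ℚ)) (a : ↥(padicCoeffIntegers S)) : Dloc S κ ρ w →+ Dloc S κ ρ w :=
  (cohomologyMap (subgroupRepMap (Y := localRepOf (cofreeGaloisModule S ρ) w) (cofreeLocalScalar S ρ a w) (kerGroup κ w)) 1).hom.toLinearMap.toAddMonoidHom

/-- **`loc_w : H¹(Γ_∞, A_ρ) →+ D_w`** (`kerLocOf` of `cofreeGaloisModule`, on the home `subgroupH1 κ.kerSubgroup (Cofree ρ F)` of the crux's Selmer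
sets — the dialects agree by `subgroupH1_cofree_eq`). [cite: Kobayashi2003, (8.23) (p. 18)] -/
def locKer (w : HeightOneSpectrum (𝓞 ℚ)) : subgroupH1 κ.kerSubgroup (Cofree ρ ↥(padicCoeffField S)) →+ Dloc S κ ρ w :=
  (kerLocOf (cofreeGaloisModule S ρ) κ w).hom.toLinearMap.toAddMonoidHom

variable (S₀ : Finset (HeightOneSpectrum (𝓞 ℚ)))

/-- **The primes of `ℚ_∞` above `w`, as cosets `C_w := Γ_ℚ ⧸ Γ_{n_w}`** (`2^{n_w}` of them). [cite: Washington1997, §13.1] -/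
abbrev Cosets (w : HeightOneSpectrum (𝓞 ℚ)) : Type :=
  absoluteGaloisGroup ℚ ⧸ κ.layerSubgroup (nfl w)

/-- **`locAway s w c := loc_w (conj_{σ_c} s)`**, `σ_c := c.out` (ANY representative — `AwayPins.locdS` is pinned with the same one): the component of
a global class at the prime of `ℚ_∞` above `w ∈ S₀` labelled by `c`. [cite: GreenbergVatsal2000, §2] [cite: Greenberg1989, §1 p. 98 (3)] -/
def locAway (s : subgroupH1 κ.kerSubgroup (Cofree ρ ↥(padicCoeffField S))) (w : ↥S₀) (c : Cosets κ (w : HeightOneSpectrum (𝓞 ℚ))) :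
    Dloc S κ ρ w :=
  locKer S κ ρ w (conjH1 κ.kerSubgroup (Cofree ρ ↥(padicCoeffField S)) c.out s)

/-- **`P_{S₀} := Π_{w ∈ S₀} Π_{c ∈ C_w} CharacterModule D_w`**, the S₀-side COMPACT module (Pontryagin model; `ℤ₂`-module through the pinned binder
instances on the `D_w`). [cite: GreenbergVatsal2000, §2 Prop. 2.4] [cite: MilneADT2006, Ch. I, Thm. 4.10] -/
abbrev PAway : Type :=
  ∀ w : ↥S₀, Cosets κ (w : HeightOneSpectrum (𝓞 ℚ)) → CharacterModule (Dloc S κ ρ w)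

variable (W : WeierstrassCurve ℚ) [W.IsElliptic] (γ : absoluteGaloisGroup ℚ) (n : ℕ)
  (Θ : ∀ v : HeightOneSpectrum (𝓞 ℚ), ((2 : ℕ) : 𝓞 ℚ) ∈ v.asIdeal → (Cofree ρ ↥(padicCoeffField S) ≃+ (Fin n → ↥(W.geomPrimaryTorsion 2))))
  (hΘ : ∀ v hv (δ : absoluteGaloisGroup (v.adicCompletion ℚ)) m i,
    Θ v hv (resGalOfEmb (closureEmb (K := ℚ) (v.adicCompletion ℚ)) δ • m) i = resGalOfEmb (closureEmb (K := ℚ) (v.adicCompletion ℚ)) δ • Θ v hv m i)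
  (I : Kato2004.IwasawaH1DataCoeff (FramedGaloisRep.toGaloisRep ρ) 2 κ γ)
  (Sg : AddSubgroup (subgroupH1 κ.kerSubgroup (Cofree ρ ↥(padicCoeffField S)))) [Module ↥(padicCoeffIntegers S) ↥Sg]
  (π : OnePairPins S W κ γ S₀ n ρ Θ hΘ I Sg) [∀ w : ↥S₀, Module ℤ_[2] (Dloc S κ ρ (w : HeightOneSpectrum (𝓞 ℚ)))]

/-- **The S₀-side pin bundle `AwayPins π`** (over `π`'s self-dual tower `ePk` and BINDER `ℤ₂`-structures on the `D_w`): `hD` pins those structures to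
`DlocSMul`; `locdS : 𝐇¹ →+ P_{S₀}` is THE S₀-side localisation-with-duality, `ℤ₂`-compatible (`hlocdS_smul`, N5's `hlocd` shape) and VALUE-PINNED
levelwise from the floor (`hlocdS`): its `(w, c)`-component on `j_{m,k} y` is `⟨red_{2^k}(conj_{σ_c} proj_m x), y⟩_{m,2^k} / 2^k ∈ ℚ/ℤ` (layer-independent by
`ThetaTransport.rhoAwayPairingPk_conj_proj_of_le`, p696153). Nothing asserted; existence (glue over `(m, k)`) is proved elsewhere; `Nonempty` assumed nowhere.
[cite: PerrinRiou1994Invent, §3.6.1] [cite: Kato2004Asterisque, §13.8 (pp. 228–229)] [cite: GreenbergVatsal2000, §2 Prop. 2.4] -/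
structure AwayPins : Type where
  /-- the binder `ℤ₂`-structure on each `D_w` IS the functorial scalar action -/
  hD : ∀ (w : ↥S₀) (a : ℤ_[2]) (y : Dloc S κ ρ (w : HeightOneSpectrum (𝓞 ℚ))), a • y = DlocSMul S κ ρ w (padicIntToCoeffIntegers S a) y
  /-- THE S₀-side localisation-with-duality `𝐇¹ →+ P_{S₀}` -/
  locdS : I.H →+ PAway S κ ρ S₀
  /-- `locdS` is `ℤ₂`-compatible -/
  hlocdS_smul : ∀ (a : ℤ_[2]) (x : I.H), locdS ((PowerSeries.C (padicIntToCoeffIntegers S a) : IwasawaAlgebraO S) • x) = a • locdS x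
  /-- the VALUE PIN of `locdS`, levelwise from the floor `n_w` -/
  hlocdS : ∀ (w : ↥S₀) (c : Cosets κ (w : HeightOneSpectrum (𝓞 ℚ))) (m : ℕ), nfl (w : HeightOneSpectrum (𝓞 ℚ)) ≤ m → ∀ (k : ℕ) (x : I.H)
    (y : Dlev S κ ρ w m k),
    locdS x w c (jAway S κ ρ w m k y) =
      (layerPairingOf (cofreeTorsionGaloisModule S ρ ((2 ^ k : ℕ) : ℤ)) (2 ^ k) (π.ePk k) (π.hμPk k) (π.hadd₁Pk k) (π.hadd₂Pk k) (π.hgalPk k) κ w m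
        (reduceH1CofreePkTorsion S ρ k (κ.layerSubgroup m)
          (conjMap (FramedGaloisRep.toGaloisRep ρ).toTopRep (κ.layerSubgroup m) c.out 1 (I.proj m x))) y).val •
        ((((2 : ℚ) ^ k)⁻¹ : ℚ) : AddCircle (1 : ℚ))

end AwayFrame

/-! ## The side at `2` beyond `π` and the relaxed Selmer subgroup (for the EH / S4₂ / S4₀ texts) -/

section AtTwo

open Literature.NumberTheory.EllipticCurves.CyclotomicLayer CategoryTheory

variable (S : Set (PadicAlgCl 2)) (κ : ZpExtension ℚ 2) (ρ : FramedGaloisRep ℚ ↥(padicCoeffIntegers S) 2)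
  (S₀ : Finset (HeightOneSpectrum (𝓞 ℚ)))

/-- **The relaxed Selmer subgroup `SelRel ≤ H¹(Γ_∞, A_ρ)`** ((C4); by `selRel_eq_unrInf`, p695679, the relaxed Kummer clause at `2` is automatic, so
`SelRel` = classes unramified outside `2·S₀` and trivial at the real place, all conjugates) — an `AddSubgroup` (data), the test space of EH / S4₂ / S4₀.
[cite: GreenbergVatsal2000, §2 pp. 16, 23] [cite: Greenberg1989, §1 p. 98 (3)] -/
def selRelSubgroup : AddSubgroup (subgroupH1 κ.kerSubgroup (Cofree ρ ↥(padicCoeffField S))) :=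
  GreenbergVatsal2000.unramifiedOutside κ.kerSubgroup (Cofree ρ ↥(padicCoeffField S)) 2 (↑S₀ : Set (HeightOneSpectrum (𝓞 ℚ))) ⊓
    ⨅ (w : NumberField.InfinitePlace ℚ) (σ : absoluteGaloisGroup ℚ),
      (GreenbergSelmer.infKer κ.kerSubgroup (Cofree ρ ↥(padicCoeffField S)) w).comap
        (conjH1 κ.kerSubgroup (Cofree ρ ↥(padicCoeffField S)) σ)

/-- Membership in `selRelSubgroup`. [cite: GreenbergVatsal2000, §2 pp. 16, 23] -/
theorem mem_selRelSubgroup_iff (y : subgroupH1 κ.kerSubgroup (Cofree ρ ↥(padicCoeffField S))) :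
    y ∈ selRelSubgroup S κ ρ S₀ ↔
      y ∈ GreenbergVatsal2000.unramifiedOutside κ.kerSubgroup (Cofree ρ ↥(padicCoeffField S)) 2 (↑S₀ : Set (HeightOneSpectrum (𝓞 ℚ))) ∧
      ∀ (w : NumberField.InfinitePlace ℚ) (σ : absoluteGaloisGroup ℚ),
        conjH1 κ.kerSubgroup (Cofree ρ ↥(padicCoeffField S)) σ y ∈ GreenbergSelmer.infKer κ.kerSubgroup (Cofree ρ ↥(padicCoeffField S)) w := by
  simp only [selRelSubgroup, AddSubgroup.mem_inf, AddSubgroup.mem_iInf, AddSubgroup.mem_comap]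

variable (W : WeierstrassCurve ℚ) [W.IsElliptic] (γ : absoluteGaloisGroup ℚ) (n : ℕ)
  (Θ : ∀ v : HeightOneSpectrum (𝓞 ℚ), ((2 : ℕ) : 𝓞 ℚ) ∈ v.asIdeal → (Cofree ρ ↥(padicCoeffField S) ≃+ (Fin n → ↥(W.geomPrimaryTorsion 2))))
  (hΘ : ∀ v hv (δ : absoluteGaloisGroup (v.adicCompletion ℚ)) m i,
    Θ v hv (resGalOfEmb (closureEmb (K := ℚ) (v.adicCompletion ℚ)) δ • m) i = resGalOfEmb (closureEmb (K := ℚ) (v.adicCompletion ℚ)) δ • Θ v hv m i)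
  (I : Kato2004.IwasawaH1DataCoeff (FramedGaloisRep.toGaloisRep ρ) 2 κ γ)
  (Sg : AddSubgroup (subgroupH1 κ.kerSubgroup (Cofree ρ ↥(padicCoeffField S)))) [Module ↥(padicCoeffIntegers S) ↥Sg]
  (π : OnePairPins S W κ γ S₀ n ρ Θ hΘ I Sg) [Module ℤ_[2] (Dloc S κ ρ π.v)]

/-- **The pin bundle at `2` on the DISCRETE side, `AtTwoPins π`**: a BINDER `ℤ₂`-structure on `D₂ := Dloc … π.v = H¹(ℚ_{∞,v}, A_ρ)` pinned to the
functorial action (`hD₂`), and THE local value character `c₂ : 𝔉₂ →+ CharacterModule D₂` — `ℤ₂`-compatible (`hc₂_smul`) and VALUE-PINNED on local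
Θ-Kummer data (`hc₂`: a local class represented by a cocycle `ψ` of `U_{∞,v}` whose `Θ`-transport is the Kummer cocycle of a tuple `Q` with
`2^k Q ∈ E(ℚ_{∞,v})ⁿ` takes the value `(t(2^k Q) mod 2^k) · 2^{-k}`, S2's (VAL) currency; every local class has such a datum — p695679
`exists_towerKummer_of_cocycle` — so the pin determines `c₂`). The texts' `c₂ z (loc₂ s)` is `c₂ z (locKer … π.v s)`. Nothing asserted.
[cite: Kobayashi2003, Thm. 6.2 and (8.23) (p. 18)] [cite: PerrinRiou1994Invent, §3.6.1] [cite: MilneADT2006, Ch. I §6, proof of Prop. 6.9] -/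
structure AtTwoPins : Type where
  /-- the binder `ℤ₂`-structure on `D₂` IS the functorial scalar action -/
  hD₂ : ∀ (a : ℤ_[2]) (y : Dloc S κ ρ π.v), a • y = DlocSMul S κ ρ π.v (padicIntToCoeffIntegers S a) y
  /-- THE local value character at `2` -/
  c₂ : ((Fin n → ↥(Sprung2012.localTowerPointsOfEmb κ (closureEmb (K := ℚ) (π.v.adicCompletion ℚ)) W)) →+ ℤ_[2]) →+
    CharacterModule (Dloc S κ ρ π.v)
  /-- `c₂` is `ℤ₂`-compatible -/
  hc₂_smul : ∀ (a : ℤ_[2]) (t : (Fin n → ↥(Sprung2012.localTowerPointsOfEmb κ (closureEmb (K := ℚ) (π.v.adicCompletion ℚ)) W)) →+ ℤ_[2])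
    (y : Dloc S κ ρ π.v), c₂ (a • t) y = c₂ t (a • y)
  /-- the VALUE PIN of `c₂` on local Θ-Kummer data -/
  hc₂ : ∀ (t : (Fin n → ↥(Sprung2012.localTowerPointsOfEmb κ (closureEmb (K := ℚ) (π.v.adicCompletion ℚ)) W)) →+ ℤ_[2])
    (y : Dloc S κ ρ π.v) (ψ : contOneCocycles (subgroupRep (localRepOf (cofreeGaloisModule S ρ) π.v) (kerGroup κ π.v)))
    (Q : Fin n → localPoints W (π.v.adicCompletion ℚ)) (k : ℕ)
    (hQ : ∀ i, (2 ^ k) • Q i ∈ Sprung2012.localTowerPointsOfEmb κ (closureEmb (K := ℚ) (π.v.adicCompletion ℚ)) W),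
    oneCocycleClass (subgroupRep (localRepOf (cofreeGaloisModule S ρ) π.v) (kerGroup κ π.v)) ψ = y →
    (∀ (τ : ↥(kerGroup κ π.v)) (i : Fin n), pointsMapOfEmb W (closureEmb (K := ℚ) (π.v.adicCompletion ℚ))
      ((Θ π.v π.hv (ψ.1 τ) i : ↥(W.geomPrimaryTorsion 2)) : W.geomPoints) = (τ : absoluteGaloisGroup (π.v.adicCompletion ℚ)) • Q i - Q i) →
    c₂ t y = (PadicInt.toZModPow k (t (fun i => ⟨(2 ^ k) • Q i, hQ i⟩))).val • ((((2 : ℚ) ^ k)⁻¹ : ℚ) : AddCircle (1 : ℚ))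

end AtTwo

end Summit.BirchSwinnertonDyer.BirchSwinnertonDyer.Theorems.OnePair

end
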